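import Summits.SmoothPoincare4.SmoothPoincare4.Theorems.SullivanDualWitnessChargeCapDefs
import Summits.SmoothPoincare4.SmoothPoincare4.Theorems.SullivanDualWitnessChargeV15MemberSphereAux

/-!
# Stub `stub_memberSphere` of skeleton v15 (crux `WitnessCharge`, stmt-SmoothPoincare4-7824,
route `SullivanDual`, line `Sketch`, lead c8): the compactified member and the far sphere in
the cap model

For the cap data `D : CapData S p J ε'` (`Theorems/SullivanDualWitnessChargeCapDefs.lean`: the
one-chart end cap `X = (Σ ∖ p) ∪ {‖t‖ < ρ} × ℂ_σ` glued along `(t, σ) = (1/z, w)`) we prove the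
registered stub `stub_memberSphere`:

* (a) every pencil member has an admissible scale (`helper_memberSphere_scale`);
* (b) at an admissible scale the charts `U = sphereU` (`ζ ↦ ι (u (lam ζ))`) and `V = sphereV`
  (`w ↦ ι (u (lam / w))`, `0 ↦ capPt b`) form an EMBEDDED `JX`-holomorphic two-chart sphere:
  `U` is smooth, `JX`-holomorphic (`dι = id`, `JX ∘ ι = J`, scaling is complex linear), injective
  and immersed; `V = U ∘ (·)⁻¹` off `0`, and AT `0` it is `capInv ∘ k` for the analytic germ `k`
  of the member at infinity (`helper_memberSphere_capGerm`, `helper_memberSphere_Vzero`: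
  removable singularity of `(1/z, w) ∘ u ∘ (lam / ·)`), so smooth, immersed (`k'(0) = (lam⁻¹, c)`)
  and `JX`-holomorphic (`JX = i` in the cap chart); `V 0 = capPt b ∉ range U`;
* (c) the far flat line of intercept `b_f` has the explicit trivial-normal-bundle witness
  `π = σ − b_f` on `N = ι(punctured ε'-ball) ∪ (cap chart domain)` (two agreeing smooth
  submersive branches `(capCoord ·).2 − b_f`, `(Ycoord ∘ ιinv ·).2 − b_f`; zero set = the far
  sphere by injectivity of the flat chart, `helper_memberSphere_eq_farLine`).
-/

noncomputable section

set_option linter.dupNamespace false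

open scoped Manifold ContDiff Topology
open Set Filter Literature.Geometry.Symplectic Literature.Topology.FourManifolds

namespace Summit.SmoothPoincare4.SmoothPoincare4.Theorems.WitnessCharge.PencilIncompleteness

section Member

variable {S : HomotopySphere 4} {p : S.carrier}
  {J : ∀ x : punctured p, TangentSpace (𝓡 4) x →L[ℝ] TangentSpace (𝓡 4) x} {ε' : ℝ}
  (D : CapData S p J ε') {u : ℂ → punctured p} {b : ℂ} {lam : ℝ}

/-! ### The `ζ`-chart `U = ι ∘ u ∘ (lam • ·)` -/

/-- The scaling `ζ ↦ lam ζ` has derivative `lam • id`. -/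
private theorem hasMFDerivAt_scale (lam : ℝ) (ζ : ℂ) :
    HasMFDerivAt 𝓘(ℝ, ℂ) 𝓘(ℝ, ℂ) (fun ζ : ℂ => (lam : ℂ) * ζ) ζ
      ((lam : ℂ) • ContinuousLinearMap.id ℝ ℂ) :=
  ((hasFDerivAt_id ζ).const_mul (lam : ℂ)).hasMFDerivAt

/-- Differential of the `ζ`-chart: `dU(ζ) v = du(lam ζ) (lam v)` (`dι = id`). -/
private theorem hasMFDerivAt_sphereU (hu : ContMDiff 𝓘(ℝ, ℂ) (𝓡 4) ∞ u) (ζ : ℂ) :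
    HasMFDerivAt 𝓘(ℝ, ℂ) (𝓡 4) (D.sphereU u lam) ζ
      ((mfderiv 𝓘(ℝ, ℂ) (𝓡 4) u ((lam : ℂ) * ζ)).comp
        ((lam : ℂ) • ContinuousLinearMap.id ℝ ℂ)) := by
  have h1 : HasMFDerivAt 𝓘(ℝ, ℂ) (𝓡 4) u ((lam : ℂ) * ζ)
      (mfderiv 𝓘(ℝ, ℂ) (𝓡 4) u ((lam : ℂ) * ζ)) :=
    ((hu ((lam : ℂ) * ζ)).mdifferentiableAt (by simp)).hasMFDerivAt
  have h2 : HasMFDerivAt 𝓘(ℝ, ℂ) (𝓡 4) (D.ι ∘ u) ((lam : ℂ) * ζ)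
      (mfderiv 𝓘(ℝ, ℂ) (𝓡 4) u ((lam : ℂ) * ζ)) :=
    ((D.hasMFDerivAt_ι (u ((lam : ℂ) * ζ))).comp ((lam : ℂ) * ζ) h1).congr_mfderiv
      (by ext v; rfl)
  exact h2.comp ζ (hasMFDerivAt_scale lam ζ)

/-- Pointwise form of the differential of the `ζ`-chart. -/
private theorem mfderiv_sphereU_apply (hu : ContMDiff 𝓘(ℝ, ℂ) (𝓡 4) ∞ u) (ζ v : ℂ) :
    mfderiv 𝓘(ℝ, ℂ) (𝓡 4) (D.sphereU u lam) ζ v =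
      mfderiv 𝓘(ℝ, ℂ) (𝓡 4) u ((lam : ℂ) * ζ) ((lam : ℂ) * v) := by
  rw [(hasMFDerivAt_sphereU D hu ζ).mfderiv]
  rfl

/-- The `ζ`-chart is smooth. -/
private theorem contMDiff_sphereU (hu : ContMDiff 𝓘(ℝ, ℂ) (𝓡 4) ∞ u) :
    ContMDiff 𝓘(ℝ, ℂ) (𝓡 4) ∞ (D.sphereU u lam) :=
  D.contMDiff_ι.comp (hu.comp (contDiff_const.mul contDiff_id).contMDiff)

/-- The `ζ`-chart is `JX`-holomorphic (`JX ∘ dι = J`, scaling is complex linear). -/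
private theorem isJHolomorphic_sphereU (hu : ContMDiff 𝓘(ℝ, ℂ) (𝓡 4) ∞ u)
    (hhol : IsJHolomorphic (𝓡 4) J u) :
    IsJHolomorphic (𝓡 4) (fun y => D.JX y) (D.sphereU u lam) := by
  intro ζ v
  show mfderiv 𝓘(ℝ, ℂ) (𝓡 4) (D.sphereU u lam) ζ (Complex.I * v) =
    D.JX (D.ι (u ((lam : ℂ) * ζ))) (mfderiv 𝓘(ℝ, ℂ) (𝓡 4) (D.sphereU u lam) ζ v)
  rw [mfderiv_sphereU_apply D hu, mfderiv_sphereU_apply D hu, D.JX_ι,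
    show (lam : ℂ) * (Complex.I * v) = Complex.I * ((lam : ℂ) * v) by ring]
  exact hhol _ _

/-- The `ζ`-chart is an immersion at an admissible (nonzero) scale. -/
private theorem injective_mfderiv_sphereU (hu : ContMDiff 𝓘(ℝ, ℂ) (𝓡 4) ∞ u)
    (himm : ∀ ξ : ℂ, Function.Injective (mfderiv 𝓘(ℝ, ℂ) (𝓡 4) u ξ)) (hlam : lam ≠ 0)
    (ζ : ℂ) : Function.Injective (mfderiv 𝓘(ℝ, ℂ) (𝓡 4) (D.sphereU u lam) ζ) := by
  intro v v' h
  rw [mfderiv_sphereU_apply D hu ζ v, mfderiv_sphereU_apply D hu ζ v'] at h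
  have key : (v : ℂ) = v' :=
    mul_left_cancel₀ (M₀ := ℂ) (Complex.ofReal_ne_zero.2 hlam) (himm ((lam : ℂ) * ζ) h)
  exact key

/-- The `ζ`-chart is injective at a nonzero scale. -/
private theorem injective_sphereU (hinj : Function.Injective u) (hlam : lam ≠ 0) :
    Function.Injective (D.sphereU u lam) := fun _ _ h =>
  mul_left_cancel₀ (Complex.ofReal_ne_zero.2 hlam) (hinj (D.isOpenEmbedding_ι.injective h))

/-! ### The `w`-chart away from `w = 0`: `V = U ∘ (·)⁻¹` -/

/-- `V w = U w⁻¹` for `w ≠ 0` (definitional). -/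
private theorem sphereV_eq_sphereU_inv {w : ℂ} (hw : w ≠ 0) :
    D.sphereV u b lam w = D.sphereU u lam w⁻¹ := by
  rw [D.sphereV_apply_of_ne u b lam hw, D.sphereU_apply]

/-- Near `w ≠ 0`, `V` agrees with `U ∘ (·)⁻¹`. -/
private theorem sphereV_eventuallyEq {w : ℂ} (hw : w ≠ 0) :
    D.sphereV u b lam =ᶠ[𝓝 w] (D.sphereU u lam ∘ Inv.inv) := by
  filter_upwards [isOpen_ne.mem_nhds hw] with z hz
  exact sphereV_eq_sphereU_inv D hz

/-- `V` is smooth at every `w ≠ 0`. -/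
private theorem contMDiffAt_sphereV_of_ne (hu : ContMDiff 𝓘(ℝ, ℂ) (𝓡 4) ∞ u) {w : ℂ}
    (hw : w ≠ 0) : ContMDiffAt 𝓘(ℝ, ℂ) (𝓡 4) ∞ (D.sphereV u b lam) w :=
  (((contMDiff_sphereU D hu) w⁻¹).comp w (contDiffAt_inv ℝ hw).contMDiffAt).congr_of_eventuallyEq
    (sphereV_eventuallyEq D hw)

/-- Differential of `V` at `w ≠ 0`: `dV(w) v = dU(w⁻¹) (d(·)⁻¹(w) v)`. -/
private theorem mfderiv_sphereV_of_ne_apply (hu : ContMDiff 𝓘(ℝ, ℂ) (𝓡 4) ∞ u) {w : ℂ}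
    (hw : w ≠ 0) (v : ℂ) :
    mfderiv 𝓘(ℝ, ℂ) (𝓡 4) (D.sphereV u b lam) w v =
      mfderiv 𝓘(ℝ, ℂ) (𝓡 4) (D.sphereU u lam) w⁻¹ (fderiv ℝ (Inv.inv : ℂ → ℂ) w v) := by
  rw [(sphereV_eventuallyEq D hw).mfderiv_eq]
  have hU : MDifferentiableAt 𝓘(ℝ, ℂ) (𝓡 4) (D.sphereU u lam) w⁻¹ :=
    ((contMDiff_sphereU D hu) w⁻¹).mdifferentiableAt (by simp)
  have hi : MDifferentiableAt 𝓘(ℝ, ℂ) 𝓘(ℝ, ℂ) (Inv.inv : ℂ → ℂ) w :=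
    (differentiableAt_inv (𝕜 := ℝ) hw).mdifferentiableAt
  rw [mfderiv_comp w hU hi, mfderiv_eq_fderiv]
  rfl

/-- The inversion `w ↦ w⁻¹` has complex-linear differential at `w ≠ 0`. -/
private theorem fderiv_inv_mul_I {w : ℂ} (hw : w ≠ 0) (v : ℂ) :
    fderiv ℝ (Inv.inv : ℂ → ℂ) w (Complex.I * v) = Complex.I * fderiv ℝ (Inv.inv : ℂ → ℂ) w v := by
  rw [(differentiableAt_inv (𝕜 := ℂ) hw).fderiv_restrictScalars ℝ]
  simp only [ContinuousLinearMap.coe_restrictScalars']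
  rw [← smul_eq_mul, ContinuousLinearMap.map_smul, smul_eq_mul]

/-- `V` is `JX`-holomorphic at every `w ≠ 0`. -/
private theorem sphereV_hol_of_ne (hu : ContMDiff 𝓘(ℝ, ℂ) (𝓡 4) ∞ u)
    (hhol : IsJHolomorphic (𝓡 4) J u) {w : ℂ} (hw : w ≠ 0) (v : ℂ) :
    mfderiv 𝓘(ℝ, ℂ) (𝓡 4) (D.sphereV u b lam) w (Complex.I * v) =
      D.JX (D.sphereV u b lam w) (mfderiv 𝓘(ℝ, ℂ) (𝓡 4) (D.sphereV u b lam) w v) := by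
  have hJ : ∀ w' : EuclideanSpace ℝ (Fin 4),
      D.JX (D.sphereV u b lam w) w' = D.JX (D.sphereU u lam w⁻¹) w' := fun w' =>
    congrArg (fun y : D.X =>
      (D.JX y : EuclideanSpace ℝ (Fin 4) →L[ℝ] EuclideanSpace ℝ (Fin 4)) w')
      (sphereV_eq_sphereU_inv D hw)
  rw [hJ, mfderiv_sphereV_of_ne_apply D hu hw, mfderiv_sphereV_of_ne_apply D hu hw,
    fderiv_inv_mul_I hw]
  exact isJHolomorphic_sphereU D hu hhol _ _

/-! ### The far sphere: the explicit normal witness `π = σ − b_f` -/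

/-- **The far sphere has the explicit trivial-normal-bundle witness `π = σ − b_f`.** On
`N = ι(punctured ε'-ball) ∪ (cap chart domain)` put `π = (capCoord ·).2 − b_f` on the cap chart
domain and `π = (Ycoord ∘ ιinv ·).2 − b_f` on `ι(ball)`; the two agree on the overlap
(`capInv (t, σ) = ι x` with `Ycoord x = (t⁻¹, σ)`), both are smooth submersions (`d capCoord` is
onto by `mfderiv_capCoord_comp`, `d Ycoord` by `helper_memberSphere_YcoordSubmersion`), and the
zero set is the far sphere because the flat chart is injective on the ball
(`helper_memberSphere_eq_farLine`). -/
private theorem farWitness (hε' : 0 < ε')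
    (hball : Metric.closedBall (extChartAt (𝓡 4) p p) ε' ⊆ (extChartAt (𝓡 4) p).target)
    {bf : ℂ} (hbf : ε'⁻¹ < ‖bf‖) (hsc : D.AdmissibleScale (farLine hε' hball hbf) lam) :
    ∃ (N : Set D.X) (π : D.X → ℂ), IsOpen N ∧
      range (D.sphereU (farLine hε' hball hbf) lam) ∪
        {D.sphereV (farLine hε' hball hbf) bf lam 0} ⊆ N ∧
      ContMDiffOn (𝓡 4) 𝓘(ℝ, ℂ) ∞ π N ∧
      (∀ y ∈ N, Function.Surjective (mfderiv (𝓡 4) 𝓘(ℝ, ℂ) π y)) ∧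
      {y | y ∈ N ∧ π y = 0} =
        range (D.sphereU (farLine hε' hball hbf) lam) ∪
          {D.sphereV (farLine hε' hball hbf) bf lam 0} := by
  classical
  have hlam0 : lam ≠ 0 := by have := hsc.1; positivity
  have hlamC : (lam : ℂ) ≠ 0 := Complex.ofReal_ne_zero.2 hlam0
  have h0ρ : ‖((0 : ℂ), bf).1‖ < D.ρ := by rw [norm_zero]; exact D.ρ_pos
  -- the two open pieces of `N`
  set B : Set (punctured p) := {x | InPuncturedChartBall p ε' x} with hB
  set C : Set D.X := D.capInv '' {q : ℂ × ℂ | ‖q.1‖ < D.ρ} with hC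
  have hBo : IsOpen B :=
    (gromov_recognitionR4_relEnd.isOpen_chartBall p ε').preimage continuous_subtype_val
  have hCo : IsOpen C := D.isOpen_capDom
  have hιBo : IsOpen (D.ι '' B) := D.isOpenEmbedding_ι.isOpenMap _ hBo
  -- points of the cap chart domain in `range ι`
  have hCι : ∀ q : ℂ × ℂ, ‖q.1‖ < D.ρ → ∀ x : punctured p, D.capInv q = D.ι x →
      InPuncturedChartBall p ε' x ∧ Ycoord p x = (q.1⁻¹, q.2) := by
    intro q hq x hx
    have hq0 : q.1 ≠ 0 := by
      intro h0
      rw [show q = (0, q.2) from Prod.ext h0 rfl, D.capInv_zero] at hx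
      exact D.ι_ne_capPt x q.2 hx.symm
    obtain ⟨x', hx', hb', hY'⟩ := D.capInv_flat q hq hq0
    rw [hx] at hx'
    obtain rfl := D.isOpenEmbedding_ι.injective hx'
    exact ⟨hb', hY'⟩
  -- the flat chart is injective on the ball: identification of far-line points
  have hfar := helper_memberSphere_eq_farLine S p ε' hε' hball bf hbf
  -- the witness `π` and its two branches
  set π : D.X → ℂ := fun y =>
    (if y ∈ C then (D.capCoord y).2 else (Ycoord p (D.ιinv y)).2) - bf with hπdef
  have hπC : ∀ q : ℂ × ℂ, ‖q.1‖ < D.ρ → π (D.capInv q) = q.2 - bf := fun q hq => by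
    have hmem : D.capInv q ∈ C := ⟨q, hq, rfl⟩
    simp only [hπdef, if_pos hmem, D.capCoord_capInv q hq]
  have hπι : ∀ x : punctured p, InPuncturedChartBall p ε' x →
      π (D.ι x) = (Ycoord p x).2 - bf := fun x hx => by
    by_cases hmem : D.ι x ∈ C
    · obtain ⟨q, hq, hqx⟩ := hmem
      rw [← hqx, hπC q hq, (hCι q hq x hqx).2]
    · simp only [hπdef, if_neg hmem, D.ιinv_ι]
  have hπC_ev : ∀ y ∈ C, π =ᶠ[𝓝 y] fun y => (D.capCoord y).2 - bf := fun y hy => by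
    filter_upwards [hCo.mem_nhds hy] with y' hy'
    simp only [hπdef, if_pos hy']
  have hπι_ev : ∀ x : punctured p, InPuncturedChartBall p ε' x →
      π =ᶠ[𝓝 (D.ι x)] fun y => (Ycoord p (D.ιinv y)).2 - bf := fun x hx => by
    filter_upwards [hιBo.mem_nhds ⟨x, hx, rfl⟩] with y' hy'
    obtain ⟨x', hx', rfl⟩ := hy'
    rw [hπι x' hx', D.ιinv_ι]
  have hsub : ContDiff ℝ ∞ (fun q : ℂ × ℂ => q.2 - bf) := contDiff_snd.sub contDiff_const
  have hsub' : ∀ q : ℂ × ℂ, HasMFDerivAt 𝓘(ℝ, ℂ × ℂ) 𝓘(ℝ, ℂ) (fun q : ℂ × ℂ => q.2 - bf) q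
      (ContinuousLinearMap.snd ℝ ℂ ℂ) := fun q => (hasFDerivAt_snd.sub_const bf).hasMFDerivAt
  -- branch 1: the cap chart domain
  have hcap : ∀ y ∈ C, ContMDiffAt (𝓡 4) 𝓘(ℝ, ℂ × ℂ) ∞ D.capCoord y := fun y hy =>
    D.contMDiffOn_capCoord.contMDiffAt (hCo.mem_nhds hy)
  have hg₁ : ∀ y ∈ C, ContMDiffAt (𝓡 4) 𝓘(ℝ, ℂ) ∞ π y := fun y hy =>
    (hsub.contDiffAt.comp_contMDiffAt (g := fun q : ℂ × ℂ => q.2 - bf) (f := D.capCoord)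
      (hcap y hy)).congr_of_eventuallyEq (hπC_ev y hy)
  have hdg₁ : ∀ q : ℂ × ℂ, ‖q.1‖ < D.ρ →
      Function.Surjective (mfderiv (𝓡 4) 𝓘(ℝ, ℂ) π (D.capInv q)) := fun q hq => by
    have hy : D.capInv q ∈ C := ⟨q, hq, rfl⟩
    have hπ' := ((hsub' _).comp (D.capInv q)
      (((hcap _ hy).mdifferentiableAt (by simp)).hasMFDerivAt)).congr_of_eventuallyEq (hπC_ev _ hy)
    rw [hπ'.mfderiv]
    intro c
    have key := ContinuousLinearMap.ext_iff.1 (D.mfderiv_capCoord_comp q hq) (0, c)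
    simp only [ContinuousLinearMap.comp_apply] at key
    exact ⟨mfderiv 𝓘(ℝ, ℂ × ℂ) (𝓡 4) D.capInv q (0, c), by
      show ((mfderiv (𝓡 4) 𝓘(ℝ, ℂ × ℂ) D.capCoord (D.capInv q))
        (mfderiv 𝓘(ℝ, ℂ × ℂ) (𝓡 4) D.capInv q (0, c))).2 = c
      rw [key]
      rfl⟩
  -- branch 2: `ι(ball)`
  have hg₂ : ∀ x : punctured p, InPuncturedChartBall p ε' x →
      ContMDiffAt (𝓡 4) 𝓘(ℝ, ℂ) ∞ π (D.ι x) ∧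
        Function.Surjective (mfderiv (𝓡 4) 𝓘(ℝ, ℂ) π (D.ι x)) := fun x hx => by
    have hx' : InPuncturedChartBall p ε' (D.ιinv (D.ι x)) := by rw [D.ιinv_ι]; exact hx
    have h1 : ContMDiffAt (𝓡 4) (𝓡 4) ∞ D.ιinv (D.ι x) :=
      D.contMDiffOn_ιinv.contMDiffAt (D.isOpenEmbedding_ι.isOpen_range.mem_nhds ⟨x, rfl⟩)
    have h2 : ContMDiffAt (𝓡 4) 𝓘(ℝ, ℂ × ℂ) ∞ (Ycoord p ∘ D.ιinv) (D.ι x) :=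
      (contMDiffAt_Ycoord hx').comp (D.ι x) h1
    refine ⟨(hsub.contDiffAt.comp_contMDiffAt (g := fun q : ℂ × ℂ => q.2 - bf)
      (f := Ycoord p ∘ D.ιinv) h2).congr_of_eventuallyEq (hπι_ev x hx), ?_⟩
    have hY := (((contMDiffAt_Ycoord hx').mdifferentiableAt (by simp)).hasMFDerivAt).comp (D.ι x)
      (D.hasMFDerivAt_ιinv x)
    have hπ' := ((hsub' _).comp (D.ι x) hY).congr_of_eventuallyEq (hπι_ev x hx)
    rw [hπ'.mfderiv]
    intro c
    obtain ⟨v, hv⟩ := helper_memberSphere_YcoordSubmersion S p ε' _ hx' (0, c)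
    exact ⟨v, by
      show ((mfderiv (𝓡 4) 𝓘(ℝ, ℂ × ℂ) (Ycoord p) (D.ιinv (D.ι x))) v).2 = c
      rw [hv]⟩
  -- membership of the far sphere in `N`
  have hUmem : ∀ ζ : ℂ, D.sphereU (farLine hε' hball hbf) lam ζ ∈ D.ι '' B := fun ζ =>
    ⟨_, farLine_mem_ball hε' hball hbf _, (D.sphereU_apply _ _ _).symm⟩
  have hV0 : D.sphereV (farLine hε' hball hbf) bf lam 0 = D.capInv (0, bf) := by
    rw [D.sphereV_zero, D.capInv_zero]
  have hVmem : D.sphereV (farLine hε' hball hbf) bf lam 0 ∈ C := hV0 ▸ ⟨(0, bf), h0ρ, rfl⟩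
  refine ⟨D.ι '' B ∪ C, π, hιBo.union hCo, ?_, ?_, ?_, ?_⟩
  · rintro y (⟨ζ, rfl⟩ | hy)
    · exact Or.inl (hUmem ζ)
    · rw [mem_singleton_iff.1 hy]
      exact Or.inr hVmem
  · rintro y (⟨x, hx, rfl⟩ | hy)
    · exact (hg₂ x hx).1.contMDiffWithinAt
    · exact (hg₁ y hy).contMDiffWithinAt
  · rintro y (⟨x, hx, rfl⟩ | ⟨q, hq, rfl⟩)
    · exact (hg₂ x hx).2
    · exact hdg₁ q hq
  · ext y
    simp only [mem_setOf_eq, mem_union, mem_range, mem_singleton_iff]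
    constructor
    · rintro ⟨(⟨x, hx, rfl⟩ | ⟨q, hq, rfl⟩), hπy⟩
      · rw [hπι x hx, sub_eq_zero] at hπy
        refine Or.inl ⟨(lam : ℂ)⁻¹ * (Ycoord p x).1, ?_⟩
        rw [D.sphereU_apply, mul_inv_cancel_left₀ hlamC, ← hfar x hx hπy]
      · rw [hπC q hq, sub_eq_zero] at hπy
        by_cases hq0 : q.1 = 0
        · right
          rw [show q = (0, bf) from Prod.ext hq0 hπy, ← hV0]
        · left
          obtain ⟨x, hxq, hxB, hxY⟩ := D.capInv_flat q hq hq0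
          have hx1 : q.1⁻¹ = (Ycoord p x).1 := by rw [hxY]
          refine ⟨(lam : ℂ)⁻¹ * q.1⁻¹, ?_⟩
          rw [D.sphereU_apply, mul_inv_cancel_left₀ hlamC, hxq, hx1,
            ← hfar x hxB (by rw [hxY, hπy])]
    · rintro (⟨ζ, rfl⟩ | rfl)
      · refine ⟨Or.inl (hUmem ζ), ?_⟩
        rw [D.sphereU_apply, hπι _ (farLine_mem_ball hε' hball hbf _), Ycoord_farLine, sub_self]
      · exact ⟨Or.inr hVmem, by rw [hV0, hπC (0, bf) h0ρ, sub_self]⟩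

end Member

/-! ### The stub -/

/-- **Stub S3 — the compactified member and the far sphere**: every member has an admissible
scale; at an admissible scale the two charts `sphereU`, `sphereV` form an EMBEDDED `JX`-holomorphic
two-chart sphere of the cap model (smooth — at `w = 0` by the removable singularity of
`(z⁻¹, w) ∘ u ∘ (lam / ·)`, holomorphic in the flat coordinates — related by `V w = U w⁻¹`,
`JX`-holomorphic, injective, immersed, `V 0 = capPt b ∉ range U`); and the far flat line of
intercept `b_f` (`‖b_f‖ > ε'⁻¹`, a member by `isPencilMember_farLine`) has the explicit
trivial-normal-bundle witness `π = w − b_f` (`= σ − b_f` in the cap chart) on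
`N = ι(punctured ε'-ball) ∪ (cap chart domain)`. -/
theorem stub_memberSphere :
    ∀ (S : HomotopySphere 4) (p : S.carrier)
      (J : ∀ x : punctured p, TangentSpace (𝓡 4) x →L[ℝ] TangentSpace (𝓡 4) x) (ε' : ℝ)
      (hε' : 0 < ε')
      (hball : Metric.closedBall (extChartAt (𝓡 4) p p) ε' ⊆ (extChartAt (𝓡 4) p).target),
      (∀ (x : punctured p) (v : TangentSpace (𝓡 4) x), J x (J x v) = -v) →
      (∀ x₀ : punctured p, ContMDiffAt (𝓡 4) 𝓘(ℝ, EuclideanSpace ℝ (Fin 4) →L[ℝ] EuclideanSpace ℝ (Fin 4)) ∞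
        (inTangentCoordinates (𝓡 4) (𝓡 4) (id : punctured p → punctured p) id (fun x => J x) x₀) x₀) →
      (∀ x : punctured p, InPuncturedChartBall p ε' x →
        ∀ (v : TangentSpace (𝓡 4) x) (b : EuclideanSpace ℝ (Fin 4)),
          inner ℝ (fderiv ℝ inversion (extChartAt (𝓡 4) p x.1 - extChartAt (𝓡 4) p p)
            (mfderiv (𝓡 4) 𝓘(ℝ, EuclideanSpace ℝ (Fin 4))
              (fun z : punctured p => extChartAt (𝓡 4) p z.1) x (J x v))) b
          = stdSymplecticForm (fderiv ℝ inversion (extChartAt (𝓡 4) p x.1 - extChartAt (𝓡 4) p p)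
            (mfderiv (𝓡 4) 𝓘(ℝ, EuclideanSpace ℝ (Fin 4))
              (fun z : punctured p => extChartAt (𝓡 4) p z.1) x v)) b) →
      ∀ (D : CapData S p J ε'),
      (∀ (u : ℂ → punctured p) (b : ℂ), IsPencilMember J u b → ∃ lam : ℝ, D.AdmissibleScale u lam) ∧
      (∀ (u : ℂ → punctured p) (b : ℂ) (lam : ℝ), IsPencilMember J u b → D.AdmissibleScale u lam →
        ContMDiff 𝓘(ℝ, ℂ) (𝓡 4) ∞ (D.sphereU u lam) ∧ ContMDiff 𝓘(ℝ, ℂ) (𝓡 4) ∞ (D.sphereV u b lam) ∧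
        (∀ z : ℂ, z ≠ 0 → D.sphereV u b lam z = D.sphereU u lam z⁻¹) ∧
        IsJHolomorphic (𝓡 4) (fun y => D.JX y) (D.sphereU u lam) ∧
        IsJHolomorphic (𝓡 4) (fun y => D.JX y) (D.sphereV u b lam) ∧
        Function.Injective (D.sphereU u lam) ∧
        (∀ z : ℂ, Function.Injective (mfderiv 𝓘(ℝ, ℂ) (𝓡 4) (D.sphereU u lam) z)) ∧
        Function.Injective (mfderiv 𝓘(ℝ, ℂ) (𝓡 4) (D.sphereV u b lam) 0) ∧
        D.sphereV u b lam 0 ∉ range (D.sphereU u lam)) ∧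
      (∀ (bf : ℂ) (hbf : ε'⁻¹ < ‖bf‖) (lam : ℝ), D.AdmissibleScale (farLine hε' hball hbf) lam →
        ∃ (N : Set D.X) (π : D.X → ℂ), IsOpen N ∧
          range (D.sphereU (farLine hε' hball hbf) lam) ∪ {D.sphereV (farLine hε' hball hbf) bf lam 0} ⊆ N ∧
          ContMDiffOn (𝓡 4) 𝓘(ℝ, ℂ) ∞ π N ∧
          (∀ y ∈ N, Function.Surjective (mfderiv (𝓡 4) 𝓘(ℝ, ℂ) π y)) ∧
          {y | y ∈ N ∧ π y = 0} =
            range (D.sphereU (farLine hε' hball hbf) lam) ∪ {D.sphereV (farLine hε' hball hbf) bf lam 0}) := by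
  intro S p J ε' hε' hball _hJ2 _hJs hstd D
  refine ⟨fun u b hu => helper_memberSphere_scale S p J ε' D.ρ u b hu hε' D.ρ_pos,
    fun u b lam hu hsc => ?_, fun bf hbf lam hsc => farWitness D hε' hball hbf hsc⟩
  have hlam0 : lam ≠ 0 := by have := hsc.1; positivity
  have hsm : ContMDiff 𝓘(ℝ, ℂ) (𝓡 4) ∞ u := hu.1.1
  have hhol : IsJHolomorphic (𝓡 4) J u := hu.1.2.2
  -- the `w`-chart at `0`: `helper_memberSphere_Vzero` for the cap chart of `D`
  obtain ⟨hV0sm, hV0imm, hV0hol⟩ := helper_memberSphere_Vzero S p J ε' u b lam D.ρ D.X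
    (fun y => D.JX y) D.ι D.capInv (D.sphereV u b lam) hε' hstd hu hsc D.ρ_pos
    (by rw [D.sphereV_zero, D.capInv_zero]) (fun w hw => D.sphereV_apply_of_ne u b lam hw)
    D.capInv_Ycoord D.contMDiffOn_capInv (fun q hq => (D.mfderiv_capInv_bijective q hq).1)
    D.JX_capInv
  refine ⟨contMDiff_sphereU D hsm, fun w => ?_, fun z hz => sphereV_eq_sphereU_inv D hz,
    isJHolomorphic_sphereU D hsm hhol, fun w v => ?_, injective_sphereU D hu.2.1 hlam0,
    injective_mfderiv_sphereU D hsm hu.2.2.1 hlam0, hV0imm, ?_⟩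
  · by_cases hw : w = 0
    · rw [hw]; exact hV0sm
    · exact contMDiffAt_sphereV_of_ne D hsm hw
  · by_cases hw : w = 0
    · subst hw; exact hV0hol v
    · exact sphereV_hol_of_ne D hsm hhol hw v
  · rintro ⟨ζ, hζ⟩
    rw [D.sphereV_zero, D.sphereU_apply] at hζ
    exact D.ι_ne_capPt _ _ hζ

end Summit.SmoothPoincare4.SmoothPoincare4.Theorems.WitnessCharge.PencilIncompleteness
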